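import Mathlib
import Literature.NumberTheory.LFunctions.Zhang2022.TypedSection17Identities
import Literature.NumberTheory.LFunctions.Zhang2022.Section4GaussianWeight
import HarnessLib

/-!
# Zhang (2022) §17 p. 98, the first equality of `Z22:§17.u025`: the exact WEIGHT-DEFECT identity and
# the smooth-weight estimate `n^{−β}g*(T²/n) = 1 + O(|β|log n + e^{−𝓛³⁰log²(T²/n)})`

Topic `Literature/NumberTheory/LFunctions/Zhang2022` (Landau–Siegel audit tree; verdict-neutral).
Y. Zhang, *Discrete mean estimates and the Landau–Siegel zero*, arXiv:2211.02515v1 (2022)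
[Zhang2022LandauSiegel] — **an unrefereed manuscript under adjudication; nothing here asserts or denies
its Theorems 1–2.** Lane ZHANG-L, work package WP16, helper under the leaf `Typed.Section17.Eq17_9Rel`
(§17 `I₄⁻` chain, owner zl-w16-p3; WP16-PLAN §1.6 "helpers welcome on hW").

§17 p. 98 (tex L4841), `Z22:§17.u025`: "In a way similar to the proof of (17.5), by Lemma 17.1, we find
that the right side [`𝔢₁Σ_{l<D⁴}(ν(l)/l)Σ_{l=l₁l₂}χ(l₁)τ₂(l₁)ν₁*(l₂)`] is equal to `𝔢₁Σ_{l<D⁴}ν(l)²/l + o(1)`"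
(hypothesis `hW` of the tree's edge `Section17InnerEdges.step17_u025_of`; `ν₁* = υ·[≤D⁴] ∗ nN_{β₂} ∗ nN_{β₃}`,
`nN_β(n) = n^{−β}g*(T²/n)`, `υ = μ ∗ μχ`, `ν = 1 ∗ χ`, §3/§17 of the typed files).

The manuscript's "similar to the proof of (17.5)" is the replacement of the weights `nN_β` by `1`
(cf. `Z22:§17.u007`) followed by the exact identity `χτ₂ ∗ υ ∗ 1 ∗ 1 = ν` (the `I₄⁻` twin of
`Z22:§17.u008`, "`1∗μ∗χ∗χ∗υ∗1∗1 = ν`", tree theorem `step17_u008_holds`). This file PROVES the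
algebraic half exactly and the pointwise size of the weight defect:

* `sum_chiTau_mul_nuOneStar_sub_nu_eq` — **the defect identity**: for `1 ≤ l ≤ D⁴`,
  `Σ_{l=l₁l₂} χ(l₁)τ₂(l₁)ν₁*(l₂) − ν(l) = ((χ∗μ) ∗ (nN_{β₂}∗nN_{β₃} − 1∗1))(l)` — because
  `χτ₂ = χ∗χ`, `(χ∗χ)∗(μ∗μχ) = χ∗μ` (`χ ∗ μχ = δ`, the tree's `toArithmeticFunction_chi_mul_moebiusChi`),
  `(χ∗μ)∗1∗1 = χ∗1 = ν` (`μ∗1 = δ`), and the truncation `υ·[≤D⁴]` is invisible at arguments `≤ D⁴`;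
* `norm_natCast_cpow_neg_sub_one_le` — `‖n^{−β} − 1‖ ≤ ‖β‖·log n` for `Re β = 0`, `n ≥ 1`;
* `norm_nN_sub_one_le` — `‖nN_β(n) − 1‖ ≤ ‖β‖·log n + ½·exp(−𝓛³⁰·log²(T²/n))` for `Re β = 0`,
  `1 ≤ n ≤ T²` (`g* = g` there; (4.2) `GaussWeight.abs_gWeight_sub_one_le`).

So the `hW` prover is left with the ν-weighted mean value `Σ_{l<D⁴}(ν(l)/l)((χ∗μ)∗(W − τ₂))(l) = o(1)`,
`W = nN_{β₂}∗nN_{β₃}`, where `W − τ₂` is pointwise `O(α log + e^{−𝓛^{1.1}…})` but enters WITH the signs of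
`χ∗μ` (a termwise majorant `α𝓛·τ₆` would lose; the first-order defect is `β·(χ∗log)`).

Theorems only: no definition, no claim node, no named fact. Nothing about (17.8)–(17.10), Theorems 1–2
of the source or Landau–Siegel zeros is asserted.

## References

* Y. Zhang, arXiv:2211.02515v1 (2022), §17 pp. 96–98 (tex L4735–L4750, L4841); §3 p. 12 (`υ`, `ν`);
  §4 (4.2) p. 18. [cite: Zhang2022LandauSiegel, §17 u025 p.98]
-/

noncomputable section

open Complex Real ComplexConjugate ArithmeticFunction

namespace Literature.NumberTheory.LFunctions.Zhang2022.Typed.Section17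

open Literature.NumberTheory.LFunctions.Zhang2022
open Literature.NumberTheory.LFunctions.Zhang2022.Skeleton

/-! ## §1 The smooth weights `nN_β(n) = n^{−β}g*(T²/n)` near `1` -/

section Weights

/-- `‖n^{−β} − 1‖ ≤ ‖β‖·log n` for purely imaginary `β` and `n ≥ 1` (`n^{−β} = e^{−i(Im β)log n}`,
`|e^{iθ} − 1| ≤ |θ|`). [cite: Zhang2022LandauSiegel, §17 u007 p.96] -/
theorem norm_natCast_cpow_neg_sub_one_le {β : ℂ} (hβ : β.re = 0) {n : ℕ} (hn : 1 ≤ n) :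
    ‖(n : ℂ) ^ (-β) - 1‖ ≤ ‖β‖ * Real.log n := by
  have hn0 : (n : ℂ) ≠ 0 := by exact_mod_cast (Nat.one_le_iff_ne_zero.mp hn)
  have hβI : β = (β.im : ℂ) * I := by
    apply Complex.ext <;> simp [hβ]
  have hexp : (n : ℂ) ^ (-β) = Complex.exp (I * ((-(β.im * Real.log n) : ℝ) : ℂ)) := by
    rw [Complex.cpow_def_of_ne_zero hn0, ← Complex.natCast_log]
    congr 1
    conv_lhs => rw [hβI]
    push_cast
    ring
  have hlog : 0 ≤ Real.log n := Real.log_natCast_nonneg n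
  have him : |β.im| ≤ ‖β‖ := Complex.abs_im_le_norm β
  rw [hexp]
  refine (Real.norm_exp_I_mul_ofReal_sub_one_le).trans ?_
  rw [Real.norm_eq_abs, abs_neg, abs_mul, abs_of_nonneg hlog]
  exact mul_le_mul_of_nonneg_right him hlog

/-- For purely imaginary `β` and `n ≥ 1`, `‖n^{−β}‖ = 1`. [cite: Zhang2022LandauSiegel, §17 u007 p.96] -/
theorem norm_natCast_cpow_neg_eq_one {β : ℂ} (hβ : β.re = 0) {n : ℕ} (hn : 1 ≤ n) :
    ‖(n : ℂ) ^ (-β)‖ = 1 := by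
  rw [Complex.norm_natCast_cpow_of_pos hn]
  simp [hβ]

/-- **The weight defect, pointwise**: for purely imaginary `β` and `1 ≤ n ≤ T²` (so that `g*(T²/n) =
g(T²/n)`, `T²/n ≥ 1 > 1/2`), `‖nN_β(n) − 1‖ ≤ ‖β‖·log n + ½·exp(−𝓛³⁰·log²(T²/n))` — `n^{−β} = 1 +
O(|β|log n)` and (4.2) `g(x) = 1 + O(e^{−𝓛³⁰log²x})` (`GaussWeight.abs_gWeight_sub_one_le`); needs only
`𝓛 > 0`. [cite: Zhang2022LandauSiegel, §17 u007 p.96; §4 (4.2) p.18] -/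
theorem norm_nN_sub_one_le (D : ℕ) (hℓ : 0 < ell D) {β : ℂ} (hβ : β.re = 0) {n : ℕ} (hn : 1 ≤ n)
    (hnT : (n : ℝ) ≤ bigT D ^ 2) :
    ‖nN D β n - 1‖ ≤ ‖β‖ * Real.log n +
      1 / 2 * Real.exp (-(ell D ^ 30) * Real.log (bigT D ^ 2 / n) ^ 2) := by
  have hn0 : (0 : ℝ) < n := by exact_mod_cast hn
  have hx : 1 ≤ bigT D ^ 2 / n := by rwa [le_div_iff₀ hn0, one_mul]
  have hx' : 1 / 2 < bigT D ^ 2 / n := lt_of_lt_of_le (by norm_num) hx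
  have hΛ : 0 < ell D ^ 30 := pow_pos hℓ 30
  have hg : gstar D (bigT D ^ 2 / n) = gW D (bigT D ^ 2 / n) := by rw [gstar, if_pos hx']
  have hgb : |gW D (bigT D ^ 2 / n) - 1| ≤ 1 / 2 * Real.exp (-(ell D ^ 30) * Real.log (bigT D ^ 2 / n) ^ 2) := by
    rw [gW]; exact GaussWeight.abs_gWeight_sub_one_le hΛ hx
  have hsplit : nN D β n - 1 =
      (n : ℂ) ^ (-β) * ((gW D (bigT D ^ 2 / n) : ℂ) - 1) + ((n : ℂ) ^ (-β) - 1) := by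
    rw [nN, hg]; ring
  rw [hsplit]
  refine (norm_add_le _ _).trans ?_
  rw [norm_mul, norm_natCast_cpow_neg_eq_one hβ hn, one_mul, add_comm]
  refine add_le_add (norm_natCast_cpow_neg_sub_one_le hβ hn) ?_
  rw [← Complex.ofReal_one, ← Complex.ofReal_sub, Complex.norm_real, Real.norm_eq_abs]
  exact hgb

end Weights

/-! ## §2 The exact defect identity behind the first equality of `Z22:§17.u025` -/

section Defect

variable (c' : ℝ) {D : ℕ} (χ : DirichletCharacter ℂ D)

/-- The constant sequence `1` (value at `0` discarded) is the arithmetic function `ζ`. [folklore] -/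
private theorem toArithmeticFunction_one' :
    toArithmeticFunction (fun _ : ℕ => (1 : ℂ)) = (ArithmeticFunction.zeta : ArithmeticFunction ℂ) := by
  ext n
  by_cases h : n = 0
  · simp [toArithmeticFunction, h]
  · simp [toArithmeticFunction, h, ArithmeticFunction.natCoe_apply, ArithmeticFunction.zeta_apply]

/-- The sequence `n ↦ μ(n)` (cast to `ℂ`) is the arithmetic function `↑μ`. [folklore] -/
private theorem toArithmeticFunction_moebius' :
    toArithmeticFunction (fun k : ℕ => (ArithmeticFunction.moebius k : ℂ)) =
      (ArithmeticFunction.moebius : ArithmeticFunction ℂ) := by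
  ext n
  by_cases h : n = 0
  · simp [toArithmeticFunction, h]
  · simp [toArithmeticFunction, h, ArithmeticFunction.intCoe_apply]

/-- Pointwise subtraction of arithmetic functions. [folklore] -/
private theorem af_sub_apply (f g : ArithmeticFunction ℂ) (n : ℕ) : (f - g) n = f n - g n := by
  rw [sub_eq_add_neg, ArithmeticFunction.add_apply, ArithmeticFunction.neg_apply, ← sub_eq_add_neg]

/-- A Dirichlet product evaluated at `n ≤ L` only sees its left factor at arguments `≤ L`. [folklore] -/
private theorem mul_apply_congr_left {f f' g : ArithmeticFunction ℂ} {L : ℕ}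
    (h : ∀ n, n ≤ L → f n = f' n) {n : ℕ} (hn : n ≤ L) : (f * g) n = (f' * g) n := by
  rw [ArithmeticFunction.mul_apply, ArithmeticFunction.mul_apply]
  refine Finset.sum_congr rfl fun x hx => ?_
  rw [h x.1 ((Nat.divisor_le (Nat.fst_mem_divisors_of_mem_antidiagonal hx)).trans hn)]

/-- `(χ ∗ χ)(k) = χ(k)τ₂(k)` for a Dirichlet character (completely multiplicative on `ℕ`), `k ≥ 1`.
[cite: Zhang2022LandauSiegel, §17 u024 p.98] -/
theorem chi_mul_chi_apply {k : ℕ} (hk : k ≠ 0) :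
    (toArithmeticFunction (fun m : ℕ => χ (m : ZMod D)) *
        toArithmeticFunction (fun m : ℕ => χ (m : ZMod D))) k =
      χ (k : ZMod D) * (k.divisors.card : ℂ) := by
  rw [ArithmeticFunction.mul_apply]
  have key : ∀ x ∈ k.divisorsAntidiagonal,
      (toArithmeticFunction (fun m : ℕ => χ (m : ZMod D))) x.1 *
        (toArithmeticFunction (fun m : ℕ => χ (m : ZMod D))) x.2 = χ (k : ZMod D) := by
    intro x hx
    obtain ⟨hxk, -⟩ := Nat.mem_divisorsAntidiagonal.mp hx
    have h1 : x.1 ≠ 0 := fun h => hk (by rw [← hxk, h, zero_mul])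
    have h2 : x.2 ≠ 0 := fun h => hk (by rw [← hxk, h, mul_zero])
    simp only [toArithmeticFunction, ArithmeticFunction.coe_mk, h1, h2, if_false]
    rw [← map_mul, ← Nat.cast_mul, hxk]
  rw [Finset.sum_congr rfl key, Finset.sum_const, nsmul_eq_mul, mul_comm,
    ← Nat.map_div_right_divisors, Finset.card_map]

/-- `(ζ ∗ ζ)(m) = τ₂(m)` for the arithmetic function `ζ = 𝟙_{n ≥ 1}` (as `toArithmeticFunction 1`).
[cite: Zhang2022LandauSiegel, §17 u025 p.98] -/
private theorem one_mul_one_apply (m : ℕ) :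
    (toArithmeticFunction (fun _ : ℕ => (1 : ℂ)) * toArithmeticFunction (fun _ : ℕ => (1 : ℂ))) m =
      (m.divisors.card : ℂ) := by
  rw [toArithmeticFunction_one', ArithmeticFunction.coe_mul_zeta_apply]
  have key : ∀ i ∈ m.divisors, ((ArithmeticFunction.zeta : ArithmeticFunction ℂ)) i = 1 := by
    intro i hi
    have hi0 : i ≠ 0 := (Nat.pos_of_mem_divisors hi).ne'
    simp [ArithmeticFunction.natCoe_apply, ArithmeticFunction.zeta_apply, hi0]
  rw [Finset.sum_congr rfl key, Finset.sum_const, nsmul_eq_mul, mul_one]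

/-- **The weight-defect identity** (the algebra behind the first equality of `Z22:§17.u025`): for
`1 ≤ l ≤ D⁴`,
`Σ_{l=l₁l₂} χ(l₁)τ₂(l₁)ν₁*(l₂) − ν(l) = ((χ∗μ) ∗ (nN_{β₂}∗nN_{β₃} − 1∗1))(l)`:
`χτ₂ = χ∗χ`, `(χ∗χ)∗(μ∗μχ) = χ∗μ` (`χ∗μχ = δ`), `(χ∗μ)∗1∗1 = χ∗1 = ν` (`μ∗1 = δ`), and the truncation
`υ·[≤D⁴]` in `ν₁*` is invisible at arguments `≤ D⁴`. (The manuscript's "similar to the proof of (17.5)"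
= replacing the weights `nN_β` by `1`, cf. u007/u008.) [cite: Zhang2022LandauSiegel, §17 u025 p.98] -/
theorem sum_chiTau_mul_nuOneStar_sub_nu_eq {l : ℕ} (hl : 1 ≤ l) (hlD : l ≤ D ^ 4) :
    (∑ q ∈ l.divisorsAntidiagonal,
        χ (q.1 : ZMod D) * (q.1.divisors.card : ℂ) * nuOneStar c' χ q.2) - nu χ l =
      LSeries.convolution
        (LSeries.convolution (fun k => χ (k : ZMod D)) (fun k => (ArithmeticFunction.moebius k : ℂ)))
        (fun m => LSeries.convolution (nN D (beta2 c' D)) (nN D (beta3 c' D)) m -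
          (m.divisors.card : ℂ)) l := by
  have hl0 : l ≠ 0 := Nat.one_le_iff_ne_zero.mp hl
  -- the players, as arithmetic functions
  set Z : ArithmeticFunction ℂ := toArithmeticFunction (fun _ : ℕ => (1 : ℂ)) with hZ
  set M : ArithmeticFunction ℂ :=
    toArithmeticFunction (fun k : ℕ => (ArithmeticFunction.moebius k : ℂ)) with hM
  set X : ArithmeticFunction ℂ := toArithmeticFunction (fun k : ℕ => χ (k : ZMod D)) with hX
  set MX : ArithmeticFunction ℂ :=
    toArithmeticFunction (fun k : ℕ => (ArithmeticFunction.moebius k : ℂ) * χ (k : ZMod D)) with hMX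
  set N₂ : ArithmeticFunction ℂ := toArithmeticFunction (nN D (beta2 c' D)) with hN₂
  set N₃ : ArithmeticFunction ℂ := toArithmeticFunction (nN D (beta3 c' D)) with hN₃
  set Ut : ArithmeticFunction ℂ := toArithmeticFunction (trunc (D ^ 4) (ups χ)) with hUt
  have hZM : Z * M = 1 := by
    rw [hZ, hM, toArithmeticFunction_one', toArithmeticFunction_moebius']
    exact ArithmeticFunction.coe_zeta_mul_coe_moebius
  have hMZ : M * Z = 1 := by rw [mul_comm]; exact hZM
  have hXMX : X * MX = 1 := by
    rw [hX, hMX]; exact toArithmeticFunction_chi_mul_moebiusChi χ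
  -- `υ = μ ∗ μχ` and `ν₁* = υ·[≤D⁴] ∗ nN₂ ∗ nN₃` as arithmetic functions
  have hups : toArithmeticFunction (ups χ) = M * MX := by
    simp only [ups, LSeries.convolution, ArithmeticFunction.toArithmeticFunction_eq_self, hM, hMX]
  have hnu1 : toArithmeticFunction (nuOneStar c' χ) = Ut * N₂ * N₃ := by
    simp only [nuOneStar, LSeries.convolution, ArithmeticFunction.toArithmeticFunction_eq_self,
      hUt, hN₂, hN₃]
  -- the truncation is invisible at arguments `≤ D⁴`
  have hU : ∀ n, n ≤ D ^ 4 → Ut n = (M * MX) n := by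
    intro n hn
    rw [← hups]
    by_cases h0 : n = 0
    · simp [hUt, toArithmeticFunction, h0]
    · simp [hUt, toArithmeticFunction, h0, trunc, hn]
  -- the left-hand sum as `((χ∗χ) ∗ ν₁*)(l)`
  have hLHS : ∑ q ∈ l.divisorsAntidiagonal,
      χ (q.1 : ZMod D) * (q.1.divisors.card : ℂ) * nuOneStar c' χ q.2 =
        ((Ut * N₂ * N₃) * (X * X)) l := by
    rw [mul_comm, ArithmeticFunction.mul_apply]
    refine Finset.sum_congr rfl fun q hq => ?_
    obtain ⟨hql, -⟩ := Nat.mem_divisorsAntidiagonal.mp hq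
    have h1 : q.1 ≠ 0 := fun h => hl0 (by rw [← hql, h, zero_mul])
    have h2 : q.2 ≠ 0 := fun h => hl0 (by rw [← hql, h, mul_zero])
    rw [hX, chi_mul_chi_apply χ h1, ← hnu1]
    simp [toArithmeticFunction, h2]
  -- replace `υ·[≤D⁴]` by `υ`
  have h12 : ∀ n, n ≤ D ^ 4 → (Ut * N₂) n = (M * MX * N₂) n :=
    fun n hn => mul_apply_congr_left hU hn
  have h123 : ∀ n, n ≤ D ^ 4 → (Ut * N₂ * N₃) n = (M * MX * N₂ * N₃) n :=
    fun n hn => mul_apply_congr_left h12 hn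
  have hrepl : ((Ut * N₂ * N₃) * (X * X)) l = ((M * MX * N₂ * N₃) * (X * X)) l :=
    mul_apply_congr_left h123 hlD
  -- ring identities
  have hring : (M * MX * N₂ * N₃) * (X * X) = (X * M) * (N₂ * N₃) := by
    calc (M * MX * N₂ * N₃) * (X * X) = (X * MX) * ((X * M) * (N₂ * N₃)) := by ring
      _ = (X * M) * (N₂ * N₃) := by rw [hXMX, one_mul]
  have hnu : nu χ l = ((X * M) * (Z * Z)) l := by
    have e : (X * M) * (Z * Z) = X * Z := by
      calc (X * M) * (Z * Z) = X * ((M * Z) * Z) := by ring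
        _ = X * Z := by rw [hMZ, one_mul]
    rw [e, hZ, toArithmeticFunction_one', ArithmeticFunction.coe_mul_zeta_apply, nu,
      Literature.NumberTheory.LFunctions.divisorSumChar_apply]
    refine Finset.sum_congr rfl fun d hd => ?_
    have hd0 : d ≠ 0 := (Nat.pos_of_mem_divisors hd).ne'
    simp [hX, toArithmeticFunction, hd0]
  -- the right-hand side as `((χ∗μ) ∗ (N₂N₃ − ζζ))(l)`
  have hW : toArithmeticFunction (fun m => LSeries.convolution (nN D (beta2 c' D)) (nN D (beta3 c' D)) m -
      (m.divisors.card : ℂ)) = N₂ * N₃ - Z * Z := by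
    ext m
    rw [af_sub_apply]
    by_cases hm : m = 0
    · subst hm
      simp [toArithmeticFunction]
    · have hZZ : (Z * Z) m = (m.divisors.card : ℂ) := by rw [hZ]; exact one_mul_one_apply m
      rw [hZZ]
      simp only [toArithmeticFunction, ArithmeticFunction.coe_mk, hm, if_false]
      simp only [LSeries.convolution, hN₂, hN₃]
  have hRHS : LSeries.convolution
      (LSeries.convolution (fun k => χ (k : ZMod D)) (fun k => (ArithmeticFunction.moebius k : ℂ)))
      (fun m => LSeries.convolution (nN D (beta2 c' D)) (nN D (beta3 c' D)) m -
        (m.divisors.card : ℂ)) l = ((X * M) * (N₂ * N₃ - Z * Z)) l := by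
    rw [← hW]
    simp only [LSeries.convolution, ArithmeticFunction.toArithmeticFunction_eq_self, hX, hM]
  -- assemble
  rw [hLHS, hrepl, hring, hnu, hRHS, mul_sub, af_sub_apply]

end Defect

end Literature.NumberTheory.LFunctions.Zhang2022.Typed.Section17
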